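import Summits.Ventures.HodgeRepro2.T5SU11JacobiPhaseLawInteger

/-!
# The phase law at EVERY even integer parameter `λ = 2n + 2` is a signed mixture of `n + 1` exponentials, and the
transform is the partial-fraction sum `m̂_k(2n + 2) = 2π Σ_{i ≤ n} c_{n,i}/(k − 2 − 2i)`

`Φ_{2n+2}(s) = P_n(2e^{2s} − 1)` (`T5SU11JacobiPhaseLawInteger.sphPhase_even`) is a polynomial of degree `≤ n` in
`e^{2s}`: with the Legendre polynomials as honest polynomials (`legPoly n : ℝ[X]`, Bonnet's recursion;
`legP n x = (legPoly n).eval x`, `legP_eq_eval`; `natDegree (legPoly n) ≤ n`) and the SHIFTED polynomial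
`Q_n := P_n ∘ (2X − 1)` (`legShift n`, `natDegree ≤ n`),

  **`Φ_{2n+2}(s) = Σ_{i ≤ n} c_{n,i} e^{2is}`**,  `c_{n,i} := (Q_n).coeff i`   (`sphPhase_even_eq_sum`).

Hence, for `k > 2n + 2` (the ray at `λ = 2n + 2`) and `a ≥ 0`, the Laplace tails and the transform are
partial-fraction sums with poles at `k = 2, 4, …, 2n + 2`:

  **`N(a) = ∫_a^∞ e^{−(k−2)s} Φ_{2n+2}(s) ds = Σ_{i ≤ n} c_{n,i} e^{−(k−2−2i)a}/(k − 2 − 2i)`**   (`tail_even_eq`),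
  **`m̂_k(2n + 2) = 2π Σ_{i ≤ n} c_{n,i}/(k − 2 − 2i)`**   (`jacobi_even_eq`),
  **`P_{k,2n+2}(log|a| > a) = (Σ_i c_{n,i} e^{−(k−2−2i)a}/(k − 2 − 2i)) / (Σ_i c_{n,i}/(k − 2 − 2i))`**   (`tail_prob_even_eq`,
  on the group `phase_tail_prob_even_eq`):

under `m_k φ_{2n+2} dν` the phase is a signed mixture of the exponential laws of rates `k − 2 − 2i`, `i = 0, …, n`, with
weights `c_{n,i}/(k − 2 − 2i)` normalised by their sum (`n = 1`: `c = (−1, 2)`, `T5SU11JacobiPhaseLawInteger.tail_four_eq`;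
`n = 2`: `c = (1, −6, 6)`, `tail_six_eq`). The coefficients `c_{n,i} = (−1)^{n+i} C(n, i) C(n + i, i)` are those of Mathlib's
`Polynomial.shiftedLegendre` (not identified here). Nothing is claimed about (N).

Blind lane: Mathlib + the HodgeRepro2 prefix only; no sorry; axioms ⊆ {propext, Classical.choice,
Quot.sound}.
-/

namespace Summit.Ventures.HodgeRepro2.T5SU11JacobiPhaseLawEven

open MeasureTheory MeasureTheory.Measure Metric Set Filter Topology Polynomial Finset
open T5SU11Unimodular T5SU11Fibration T5SU11Cartan T5SU11OneParameter T5SU11CartanProjection T5HaarCircle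
  T5BergmanCoefficient T5SU11FibrationHaar T5SU11SphericalFunction T5SU11SphericalSymmetry
  T5SU11SphericalBounds T5SU11SphericalContinuous T5SU11SphericalLegendreAll T5SU11JacobiLaplacePhase
  T5SU11JacobiPhaseTailGroup T5SU11JacobiPhaseLawRate T5SU11JacobiPhaseLawInteger T5SU11JacobiWeight
  T5SU11KFiniteMajorantPow
open scoped Real

/-! ### The Legendre polynomials as polynomials -/

/-- **The Legendre polynomials in `ℝ[X]`**, by Bonnet's recursion. -/
noncomputable def legPoly : ℕ → ℝ[X]
  | 0 => 1
  | 1 => X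
  | (n + 2) => C ((2 * (n : ℝ) + 3) / ((n : ℝ) + 2)) * X * legPoly (n + 1) - C (((n : ℝ) + 1) / ((n : ℝ) + 2)) * legPoly n

/-- Bonnet's recursion for `legPoly`, unfolded. -/
lemma legPoly_succ_succ (n : ℕ) :
    legPoly (n + 2) = C ((2 * (n : ℝ) + 3) / ((n : ℝ) + 2)) * X * legPoly (n + 1)
      - C (((n : ℝ) + 1) / ((n : ℝ) + 2)) * legPoly n := rfl

/-- **`P_n(x) = (legPoly n).eval x`**: the real functions of `T5SU11SphericalLegendreAll` are the evaluations. -/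
theorem legP_eq_eval_pair (n : ℕ) (x : ℝ) :
    legP n x = (legPoly n).eval x ∧ legP (n + 1) x = (legPoly (n + 1)).eval x := by
  induction n with
  | zero => exact ⟨by simp [legPoly], by simp [legPoly]⟩
  | succ n ih =>
    refine ⟨ih.2, ?_⟩
    rw [legP_succ_succ, legPoly_succ_succ, eval_sub, eval_mul, eval_mul, eval_C, eval_X, eval_mul, eval_C,
      ← ih.1, ← ih.2]
    have hn : ((n : ℝ) + 2) ≠ 0 := by positivity
    field_simp

/-- **`P_n(x) = (legPoly n).eval x`.** -/
theorem legP_eq_eval (n : ℕ) (x : ℝ) : legP n x = (legPoly n).eval x := (legP_eq_eval_pair n x).1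

/-- **`natDegree (legPoly n) ≤ n`.** -/
theorem natDegree_legPoly_le_pair (n : ℕ) :
    (legPoly n).natDegree ≤ n ∧ (legPoly (n + 1)).natDegree ≤ n + 1 := by
  induction n with
  | zero => exact ⟨by simp [legPoly], by simp [legPoly]⟩
  | succ n ih =>
    refine ⟨ih.2, ?_⟩
    rw [legPoly_succ_succ]
    refine (natDegree_sub_le _ _).trans (max_le ?_ ?_)
    · calc (C ((2 * (n : ℝ) + 3) / ((n : ℝ) + 2)) * X * legPoly (n + 1)).natDegree
          ≤ (C ((2 * (n : ℝ) + 3) / ((n : ℝ) + 2)) * X).natDegree + (legPoly (n + 1)).natDegree := natDegree_mul_le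
        _ ≤ 1 + (n + 1) := add_le_add ((natDegree_C_mul_le _ _).trans natDegree_X_le) ih.2
        _ = n + 1 + 1 := by ring
    · exact (natDegree_C_mul_le _ _).trans (ih.1.trans (by omega))

/-- **`natDegree (legPoly n) ≤ n`.** -/
theorem natDegree_legPoly_le (n : ℕ) : (legPoly n).natDegree ≤ n := (natDegree_legPoly_le_pair n).1

/-- **The shifted Legendre polynomial `Q_n(y) = P_n(2y − 1)`.** -/
noncomputable def legShift (n : ℕ) : ℝ[X] := (legPoly n).comp (C 2 * X - C 1)

/-- **`natDegree (legShift n) ≤ n`.** -/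
theorem natDegree_legShift_le (n : ℕ) : (legShift n).natDegree ≤ n := by
  unfold legShift
  refine natDegree_comp_le.trans ?_
  have h1 : (C (2 : ℝ) * X - C 1).natDegree ≤ 1 := by
    rw [natDegree_sub_C]
    exact (natDegree_C_mul_le _ _).trans natDegree_X_le
  calc (legPoly n).natDegree * (C (2 : ℝ) * X - C 1).natDegree ≤ n * 1 :=
        Nat.mul_le_mul (natDegree_legPoly_le n) h1
    _ = n := by ring

/-- **`P_n(2y − 1) = (legShift n).eval y`.** -/
theorem legP_two_mul_sub_one_eq_eval (n : ℕ) (y : ℝ) : legP n (2 * y - 1) = (legShift n).eval y := by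
  rw [legP_eq_eval, legShift, eval_comp, eval_sub, eval_mul, eval_C, eval_X, eval_C]

section measure

variable [MeasurableSpace Circle] [BorelSpace Circle]

/-- **`Φ_{2n+2}(s) = (legShift n).eval (e^{2s})`** for `s ≥ 0`. -/
theorem sphPhase_even_eq_eval (n : ℕ) {s : ℝ} (hs : 0 ≤ s) :
    sphPhase (2 * (n : ℝ) + 2) s = (legShift n).eval (Real.exp (2 * s)) := by
  rw [sphPhase_even n hs, legP_two_mul_sub_one_eq_eval]

/-- **`Φ_{2n+2}(s) = Σ_{i ≤ n} c_{n,i} e^{2is}`**, `c_{n,i} = (legShift n).coeff i`, for `s ≥ 0`. -/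
theorem sphPhase_even_eq_sum (n : ℕ) {s : ℝ} (hs : 0 ≤ s) :
    sphPhase (2 * (n : ℝ) + 2) s
      = ∑ i ∈ range (n + 1), (legShift n).coeff i * Real.exp (2 * (i : ℝ) * s) := by
  rw [sphPhase_even_eq_eval n hs,
    eval_eq_sum_range' (lt_of_le_of_lt (natDegree_legShift_le n) (Nat.lt_succ_self n))]
  refine Finset.sum_congr rfl fun i _ => ?_
  rw [← Real.exp_nat_mul]
  ring_nf

/-! ### The Laplace tails and the transform as partial-fraction sums -/

/-- **`N(a) = Σ_{i ≤ n} c_{n,i} e^{−(k−2−2i)a}/(k − 2 − 2i)`** for `k > 2n + 2`, `a ≥ 0`. -/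
theorem tail_even_eq (n : ℕ) {k : ℝ} (hk : 2 * (n : ℝ) + 2 < k) {a : ℝ} (ha : 0 ≤ a) :
    ∫ s in Ioi a, Real.exp (-((k - 2) * s)) * sphPhase (2 * (n : ℝ) + 2) s
      = ∑ i ∈ range (n + 1), (legShift n).coeff i
          * (Real.exp (-((k - 2 - 2 * (i : ℝ)) * a)) / (k - 2 - 2 * (i : ℝ))) := by
  have hi : ∀ i ∈ range (n + 1), 2 * (i : ℝ) < k - 2 := fun i hi => by
    have : (i : ℝ) ≤ n := by exact_mod_cast Nat.lt_succ_iff.mp (Finset.mem_range.mp hi)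
    linarith
  have e : ∫ s in Ioi a, Real.exp (-((k - 2) * s)) * sphPhase (2 * (n : ℝ) + 2) s
      = ∫ s in Ioi a, ∑ i ∈ range (n + 1),
          (legShift n).coeff i * (Real.exp (-((k - 2) * s)) * Real.exp (2 * (i : ℝ) * s)) := by
    refine setIntegral_congr_fun measurableSet_Ioi fun s hs => ?_
    rw [sphPhase_even_eq_sum n (le_trans ha (le_of_lt hs)), Finset.mul_sum]
    refine Finset.sum_congr rfl fun i _ => ?_
    ring
  rw [e, integral_finsetSum _ fun (i : ℕ) hi' =>
    (integrableOn_exp_neg_mul_mul_exp_Ioi (r := k - 2) (c := 2 * (i : ℝ)) (hi i hi') a).const_mul _]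
  refine Finset.sum_congr rfl fun i hi' => ?_
  rw [integral_const_mul, integral_exp_neg_mul_mul_exp_Ioi (hi i hi')]

/-- **`m̂_k(2n + 2) = 2π Σ_{i ≤ n} c_{n,i}/(k − 2 − 2i)`** for `k > 2n + 2`. -/
theorem jacobi_even_eq (n : ℕ) {k : ℝ} (hk : 2 * (n : ℝ) + 2 < k) :
    ∫ g, (1 - ‖orbit g‖ ^ 2) ^ (k / 2) * sph (2 * (n : ℝ) + 2) g ∂(nu haarCircle)
      = 2 * π * ∑ i ∈ range (n + 1), (legShift n).coeff i / (k - 2 - 2 * (i : ℝ)) := by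
  have hn0 : (0 : ℝ) ≤ n := Nat.cast_nonneg n
  rw [jacobi_eq_laplace_phase (by linarith) hk (by linarith), tail_even_eq n hk (le_refl 0)]
  congr 1
  refine Finset.sum_congr rfl fun i _ => ?_
  simp only [mul_zero, neg_zero, Real.exp_zero, one_div]
  ring

/-- **The tail probability at `λ = 2n + 2`**:
`P_{k,2n+2}(log|a| > a) = (Σ_i c_{n,i} e^{−(k−2−2i)a}/(k − 2 − 2i)) / (Σ_i c_{n,i}/(k − 2 − 2i))`. -/
theorem tail_prob_even_eq (n : ℕ) {k : ℝ} (hk : 2 * (n : ℝ) + 2 < k) {a : ℝ} (ha : 0 ≤ a) :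
    (∫ s in Ioi a, Real.exp (-((k - 2) * s)) * sphPhase (2 * (n : ℝ) + 2) s)
        / ∫ s in Ioi (0 : ℝ), Real.exp (-((k - 2) * s)) * sphPhase (2 * (n : ℝ) + 2) s
      = (∑ i ∈ range (n + 1), (legShift n).coeff i
            * (Real.exp (-((k - 2 - 2 * (i : ℝ)) * a)) / (k - 2 - 2 * (i : ℝ))))
        / ∑ i ∈ range (n + 1), (legShift n).coeff i / (k - 2 - 2 * (i : ℝ)) := by
  rw [tail_even_eq n hk ha, tail_even_eq n hk (le_refl 0)]
  congr 1
  refine Finset.sum_congr rfl fun i _ => ?_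
  simp only [mul_zero, neg_zero, Real.exp_zero, one_div]
  ring

/-- **On the group**: for `k > 2n + 2`, `a ≥ 0`,
`P_{k,2n+2}(log|a(g)| > a) = (Σ_i c_{n,i} e^{−(k−2−2i)a}/(k − 2 − 2i)) / (Σ_i c_{n,i}/(k − 2 − 2i))`. -/
theorem phase_tail_prob_even_eq (n : ℕ) {k : ℝ} (hk : 2 * (n : ℝ) + 2 < k) {a : ℝ} (ha : 0 ≤ a) :
    (∫ g in {g : SU11 | a < Real.log ‖mat g 0 0‖},
          (1 - ‖orbit g‖ ^ 2) ^ (k / 2) * sph (2 * (n : ℝ) + 2) g ∂(nu haarCircle))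
        / (∫ g, (1 - ‖orbit g‖ ^ 2) ^ (k / 2) * sph (2 * (n : ℝ) + 2) g ∂(nu haarCircle))
      = (∑ i ∈ range (n + 1), (legShift n).coeff i
            * (Real.exp (-((k - 2 - 2 * (i : ℝ)) * a)) / (k - 2 - 2 * (i : ℝ))))
        / ∑ i ∈ range (n + 1), (legShift n).coeff i / (k - 2 - 2 * (i : ℝ)) := by
  have hn0 : (0 : ℝ) ≤ n := Nat.cast_nonneg n
  rw [integral_phase_tail_eq (by linarith) hk (by linarith) ha, jacobi_eq_laplace_phase (by linarith) hk (by linarith),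
    mul_div_mul_left _ _ (by positivity : (2 * π : ℝ) ≠ 0), tail_prob_even_eq n hk ha]

end measure

end Summit.Ventures.HodgeRepro2.T5SU11JacobiPhaseLawEven
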